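import Summits.CriticalPhenomena.PercolationContinuityZ3.Theorems.PercNearOneGluingNoHeavyLowerTailLevelPackingRatio
import HarnessLib

/-!
# `NoHeavyLowerTail` (stmt-CriticalPhenomena-4575) — the LONELY-OBSERVER INEQUALITY
# (singleton pockets are paid by the champion at every level, uniformly in `|A|`)

Seat `prim-gen-swap` (gen 3), 2026-08-19.  `μ = prodBernoulli w` on `Fin n`, observer `o` (any vertex), relays `A`,
level `j ≥ 1`, `π(v) = {z ∈ A : v ↔ z}`, `R_v = {|π(v)| ≤ j}` ("small"), champion `c ∈ argmax_A μ(R_·)`.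

`lonelyObserver_le_bigBlock` — **THEOREM A** (all `|A|`, all `j ≥ 1`):

    `μ(|π(o)| = 1 ∧ |π(c)| ≥ j+1) ≤ μ(|π(o)| ≥ j+1 ∧ o ↮ c)`.

"The observer is lonely while the champion is not" is rarer than "the observer lies in a big block avoiding the
champion".  At the half level `j = ⌊|A|/2⌋` (one big block `G` at most) this is the `N = 1` share of the bad/good
accounting of `CIL(c)` (`μ(c ∈ G, B_o small ≠ ∅) ≤ μ(c ∉ G, B_o ∈ {∅, G})`, `B_o = π(o)`): singleton pockets are
dominated for every `|A|`; the open part of each rung is the multi-relay pockets (first instance: the pair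
pockets `(xy | czw)` of `(|A|, j) = (5, 2)`, where coefficientwise LPL certificates provably do not suffice — crux
evidence `CERT-STRUCTURE.md`).
Proof: for each big `T ⊆ A ∖ c` (`|T| ≥ j+1`) apply `LevelPacking.levelPackingRatio` with the singletons of `T` as
sources, the common guard `Q = {|π(c)| ≥ j+1}` (increasing, determined by the cluster of `A ∖ {x}`;
`LonelyObserver.bigFn_*`) and `t_x = β_x := μ(D_x ∩ Q)`; weight the row by `H_T = μ(T is a block)` and sum over
`T`: the source `x` receives `Σ_{T ∋ x} H_T ≥ μ(R_c ∖ R_x) ≥ μ(R_x ∖ R_c) ≥ β_x` (champion inequality), while the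
target atoms `{π(o) = T}` are disjoint pieces of `{|π(o)| ≥ j+1, o ↮ c}`.
-/

noncomputable section

namespace Summit.CriticalPhenomena.PercolationContinuityZ3.Theorems

open scoped BigOperators Classical Topology
open MeasureTheory Set Filter
open Literature.Probability.LatticeModels (prodBernoulli)
open Literature.Probability.Percolation
open BlockLonelyRelay GuardedBlockLonelyRelay AttachedChampionLevelOne

variable {n : ℕ}

/-! ## Theorem A: the lonely-observer inequality -/

namespace LonelyObserver

/-- The guard "`c` lies in a big block": `G(C) = 1` iff at least `j+1` relays are joined to `c` inside the edge set
`C`; monotone in `C`. [folklore] -/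
theorem bigFn_monotone (A : Finset (Fin n)) (c : Fin n) (j : ℕ) :
    Monotone fun C : Set (Sym2 (Fin n)) =>
      (if j + 1 ≤ (A.filter fun z => (SimpleGraph.fromEdgeSet C).Reachable c z).card then (1 : ℝ) else 0) := by
  intro C C' hCC'
  dsimp only
  by_cases h : j + 1 ≤ (A.filter fun z => (SimpleGraph.fromEdgeSet C).Reachable c z).card
  · have h' : j + 1 ≤ (A.filter fun z => (SimpleGraph.fromEdgeSet C').Reachable c z).card :=
      h.trans (Finset.card_le_card (Finset.monotone_filter_right A fun z _ hz =>
        hz.mono (SimpleGraph.fromEdgeSet_mono hCC')))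
    rw [if_pos h, if_pos h']
  · rw [if_neg h]; split_ifs <;> norm_num

/-- Evaluated at the union of the open edge clusters of a set `X ∋ c`, the guard is the indicator of
`{|π(c)| ≥ j+1}`. [folklore] -/
theorem bigFn_biUnion_openEdgeCluster (A : Finset (Fin n)) (c : Fin n) (j : ℕ) (X : Set (Fin n)) (hc : c ∈ X)
    (ω : BondConfig (Fin n)) :
    (if j + 1 ≤ (A.filter fun z =>
        (SimpleGraph.fromEdgeSet (⋃ s ∈ X, openEdgeCluster ω s)).Reachable c z).card then (1 : ℝ) else 0) =
      ({ω' : BondConfig (Fin n) | j + 1 ≤ (A.filter fun z => ω' ∈ openConn c z).card}).indicator 1 ω := by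
  have hfilt : (A.filter fun z => (SimpleGraph.fromEdgeSet (⋃ s ∈ X, openEdgeCluster ω s)).Reachable c z) =
      A.filter fun z => ω ∈ (openConn c z : Set (BondConfig (Fin n))) := by
    refine Finset.filter_congr fun z _ => ⟨fun h => ?_, fun h => ?_⟩
    · have hsub : (⋃ s ∈ X, openEdgeCluster ω s) ⊆ ω :=
        Set.iUnion₂_subset fun s _ => openEdgeCluster_subset ω s
      exact h.mono (SimpleGraph.fromEdgeSet_mono hsub)
    · have hcz : (openGraph ω).Reachable c z := h
      exact (GuardedLonelyRelay.reachable_fromEdgeSet_openEdgeCluster hcz).mono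
        (SimpleGraph.fromEdgeSet_mono (Set.subset_biUnion_of_mem hc))
  rw [hfilt]
  by_cases h : j + 1 ≤ (A.filter fun z => ω ∈ (openConn c z : Set (BondConfig (Fin n)))).card
  · rw [if_pos h, indicator_of_mem (show ω ∈ {ω' : BondConfig (Fin n) |
      j + 1 ≤ (A.filter fun z => ω' ∈ openConn c z).card} from h), Pi.one_apply]
  · rw [if_neg h, indicator_of_notMem (show ω ∉ {ω' : BondConfig (Fin n) |
      j + 1 ≤ (A.filter fun z => ω' ∈ openConn c z).card} from h)]

/-- If `x ↔ z` for every `z ∈ T ∋ x` and `x ↮ a` for `a ∈ A ∖ T` (with `T ⊆ A`), then `π(x) = T`. [folklore] -/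
theorem filter_eq_of_block {A T : Finset (Fin n)} (hTA : T ⊆ A) {x : Fin n} (hx : x ∈ T) {ω : BondConfig (Fin n)}
    (hJ : ∀ t ∈ T, ∀ t' ∈ T, ω ∈ (openConn t t' : Set (BondConfig (Fin n))))
    (hD : ∀ t ∈ T, ∀ a ∈ A \ T, ω ∉ (openConn t a : Set (BondConfig (Fin n)))) :
    (A.filter fun z => ω ∈ (openConn x z : Set (BondConfig (Fin n)))) = T := by
  ext z
  simp only [Finset.mem_filter]
  constructor
  · rintro ⟨hzA, hxz⟩
    by_contra hzT
    exact hD x hx z (Finset.mem_sdiff.2 ⟨hzA, hzT⟩) hxz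
  · intro hzT
    exact ⟨hTA hzT, hJ x hx z hzT⟩

end LonelyObserver

open LonelyObserver LevelPacking in
/-- **THEOREM A — the lonely-observer inequality** (all `|A|`, all levels `j ≥ 1`).  For any vertex `o` and a
champion `c ∈ A` (`μ(|π(a)| ≤ j) ≤ μ(|π(c)| ≤ j)` for all `a ∈ A`):

  `μ(|π(o)| = 1 ∧ |π(c)| ≥ j+1) ≤ μ(|π(o)| ≥ j+1 ∧ o ↮ c)`.

Singleton pockets of the observer are dominated, uniformly in `|A|`, by the mass of big observer blocks avoiding
the champion; proof by `levelPackingRatio` over all big targets `T ⊆ A ∖ c` with the common guard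
`{|π(c)| ≥ j+1}` and the champion inequality (module docstring). -/
theorem lonelyObserver_le_bigBlock (w : Sym2 (Fin n) → unitInterval) (A : Finset (Fin n)) (o c : Fin n)
    (j : ℕ) (hj : 1 ≤ j) (hc : c ∈ A)
    (hmax : ∀ a ∈ A,
      (prodBernoulli w).real {ω : BondConfig (Fin n) | (A.filter fun z => ω ∈ openConn a z).card ≤ j} ≤
        (prodBernoulli w).real {ω : BondConfig (Fin n) | (A.filter fun z => ω ∈ openConn c z).card ≤ j}) :
    (prodBernoulli w).real {ω : BondConfig (Fin n) |
        (A.filter fun z => ω ∈ openConn o z).card = 1 ∧ j + 1 ≤ (A.filter fun z => ω ∈ openConn c z).card} ≤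
      (prodBernoulli w).real {ω : BondConfig (Fin n) |
        j + 1 ≤ (A.filter fun z => ω ∈ openConn o z).card ∧ ω ∉ openConn o c} := by
  set μ := prodBernoulli w with hμ
  have hmeas : ∀ s : Set (BondConfig (Fin n)), MeasurableSet s := fun _ => MeasurableSet.of_discrete
  -- notation
  set Q : Set (BondConfig (Fin n)) := {ω | j + 1 ≤ (A.filter fun z => ω ∈ openConn c z).card} with hQ
  set Dx : Fin n → Set (BondConfig (Fin n)) := fun x =>
    {ω | ∀ b ∈ ({x} : Finset (Fin n)), ∀ a ∈ A \ {x}, ω ∉ openConn b a} with hDx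
  set Ex : Fin n → Set (BondConfig (Fin n)) := fun x =>
    {ω | ∃ b ∈ ({x} : Finset (Fin n)), ω ∈ openConn o b} with hEx
  set src : Fin n → Set (BondConfig (Fin n)) := fun x => Ex x ∩ Dx x ∩ Q with hsrc
  set β : Fin n → ℝ := fun x => μ.real (Dx x ∩ Q) with hβ
  set JT : Finset (Fin n) → Set (BondConfig (Fin n)) := fun T =>
    {ω | ∀ t ∈ T, ∀ t' ∈ T, ω ∈ openConn t t'} with hJT
  set DT : Finset (Fin n) → Set (BondConfig (Fin n)) := fun T =>
    {ω | ∀ t ∈ T, ∀ a ∈ A \ T, ω ∉ openConn t a} with hDT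
  set ET : Finset (Fin n) → Set (BondConfig (Fin n)) := fun T => {ω | ∃ t ∈ T, ω ∈ openConn o t} with hET
  set H : Finset (Fin n) → ℝ := fun T => μ.real (JT T ∩ DT T) with hH
  set tgt : Finset (Fin n) → ℝ := fun T => μ.real (ET T ∩ (JT T ∩ DT T)) with htgt
  set 𝒯 : Finset (Finset (Fin n)) := (A.erase c).powerset.filter fun T => j + 1 ≤ T.card with h𝒯
  have h𝒯mem : ∀ {T}, T ∈ 𝒯 ↔ T ⊆ A.erase c ∧ j + 1 ≤ T.card := by
    intro T; rw [h𝒯, Finset.mem_filter, Finset.mem_powerset]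
  have hsrc_sub : ∀ x, src x ⊆ Dx x ∩ Q := fun x ω hω => ⟨hω.1.2, hω.2⟩
  have hβ0 : ∀ x, 0 ≤ β x := fun x => measureReal_nonneg
  have hH0 : ∀ T, 0 ≤ H T := fun T => measureReal_nonneg
  -- (i) the left event is covered by the sources `src x`, `x ∈ A ∖ c`
  have hL : μ.real {ω : BondConfig (Fin n) |
      (A.filter fun z => ω ∈ openConn o z).card = 1 ∧ j + 1 ≤ (A.filter fun z => ω ∈ openConn c z).card} ≤
      ∑ x ∈ A.erase c, μ.real (src x) := by
    refine (measureReal_mono ?_ (measure_ne_top _ _)).trans (measureReal_biUnion_finset_le (μ := μ) (A.erase c) src)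
    rintro ω ⟨h1, hbig⟩
    obtain ⟨x, hx⟩ := Finset.card_eq_one.1 h1
    have hxmem : x ∈ A.filter fun z => ω ∈ (openConn o z : Set (BondConfig (Fin n))) := by
      rw [hx]; exact Finset.mem_singleton_self x
    obtain ⟨hxA, hox⟩ := Finset.mem_filter.1 hxmem
    have hox' : (openGraph ω).Reachable o x := hox
    have honly : ∀ z ∈ A, (openGraph ω).Reachable o z → z = x := by
      intro z hzA hoz
      have : z ∈ A.filter fun z => ω ∈ (openConn o z : Set (BondConfig (Fin n))) := Finset.mem_filter.2 ⟨hzA, hoz⟩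
      rw [hx] at this
      exact Finset.mem_singleton.1 this
    have hxc : x ≠ c := by
      rintro rfl
      -- then `π(c) = π(o)` has one element
      have hsub : (A.filter fun z => ω ∈ (openConn x z : Set (BondConfig (Fin n)))) ⊆ {x} := by
        intro z hz
        obtain ⟨hzA, hxz⟩ := Finset.mem_filter.1 hz
        have hxz' : (openGraph ω).Reachable x z := hxz
        exact Finset.mem_singleton.2 (honly z hzA (hox'.trans hxz'))
      have := (Finset.card_le_card hsub).trans_eq (Finset.card_singleton x)
      change j + 1 ≤ (A.filter fun z => ω ∈ (openConn x z : Set (BondConfig (Fin n)))).card at hbig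
      omega
    refine Set.mem_iUnion₂.2 ⟨x, Finset.mem_erase.2 ⟨hxc, hxA⟩, ⟨⟨x, Finset.mem_singleton_self x, hox⟩, ?_⟩, hbig⟩
    intro b hb a ha hba
    rw [Finset.mem_singleton] at hb
    subst hb
    obtain ⟨haA, hax⟩ := Finset.mem_sdiff.1 ha
    have hba' : (openGraph ω).Reachable b a := hba
    exact (Finset.notMem_singleton.1 hax) (honly a haA (hox'.trans hba'))
  -- (ii) coverage of each source by the champion inequality: `β x ≤ Σ_{T ∈ 𝒯, x ∈ T} H T`
  have hcov : ∀ x ∈ A.erase c, β x ≤ ∑ T ∈ 𝒯.filter (fun T => x ∈ T), H T := by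
    intro x hx
    obtain ⟨hxc, hxA⟩ := Finset.mem_erase.1 hx
    set Rx : Set (BondConfig (Fin n)) := {ω | (A.filter fun z => ω ∈ openConn x z).card ≤ j} with hRx
    set Rc : Set (BondConfig (Fin n)) := {ω | (A.filter fun z => ω ∈ openConn c z).card ≤ j} with hRc
    -- `D_x ∩ Q ⊆ R_x \ R_c`
    have h1 : β x ≤ μ.real (Rx \ Rc) := by
      refine measureReal_mono fun ω hω => ?_
      obtain ⟨hD, hq⟩ := hω
      constructor
      · change (A.filter fun z => ω ∈ (openConn x z : Set (BondConfig (Fin n)))).card ≤ j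
        have hsub : (A.filter fun z => ω ∈ (openConn x z : Set (BondConfig (Fin n)))) ⊆ {x} := by
          intro z hz
          obtain ⟨hzA, hxz⟩ := Finset.mem_filter.1 hz
          by_contra hzx
          exact hD x (Finset.mem_singleton_self x) z (Finset.mem_sdiff.2 ⟨hzA, hzx⟩) hxz
        exact ((Finset.card_le_card hsub).trans_eq (Finset.card_singleton x)).trans hj
      · change ¬ ((A.filter fun z => ω ∈ (openConn c z : Set (BondConfig (Fin n)))).card ≤ j)
        change j + 1 ≤ (A.filter fun z => ω ∈ (openConn c z : Set (BondConfig (Fin n)))).card at hq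
        omega
    -- champion: `μ(R_x \ R_c) ≤ μ(R_c \ R_x)`
    have h2 : μ.real (Rx \ Rc) ≤ μ.real (Rc \ Rx) := by
      have e1 := measureReal_inter_add_sdiff (μ := μ) (s := Rx) (hmeas Rc)
      have e2 := measureReal_inter_add_sdiff (μ := μ) (s := Rc) (hmeas Rx)
      rw [Set.inter_comm] at e2
      linarith [hmax x hxA]
    -- `R_c \ R_x ⊆ ⋃_{T ∈ 𝒯, x ∈ T} (J_T ∩ D_T)`  (take `T = π(x)`)
    have h3 : μ.real (Rc \ Rx) ≤ ∑ T ∈ 𝒯.filter (fun T => x ∈ T), H T := by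
      refine (measureReal_mono ?_ (measure_ne_top _ _)).trans
        (measureReal_biUnion_finset_le (μ := μ) (𝒯.filter fun T => x ∈ T) (fun T => JT T ∩ DT T))
      rintro ω ⟨hcs, hxb⟩
      change (A.filter fun z => ω ∈ (openConn c z : Set (BondConfig (Fin n)))).card ≤ j at hcs
      change ¬ ((A.filter fun z => ω ∈ (openConn x z : Set (BondConfig (Fin n)))).card ≤ j) at hxb
      set T := A.filter fun z => ω ∈ (openConn x z : Set (BondConfig (Fin n))) with hT
      have hxT : x ∈ T := Finset.mem_filter.2 ⟨hxA, (SimpleGraph.Reachable.refl x : (openGraph ω).Reachable x x)⟩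
      have hxc' : ω ∉ (openConn x c : Set (BondConfig (Fin n))) := by
        intro hxc''
        have hxcR : (openGraph ω).Reachable x c := hxc''
        have heq : T = A.filter fun z => ω ∈ (openConn c z : Set (BondConfig (Fin n))) := by
          refine Finset.filter_congr fun z _ => ⟨fun h => ?_, fun h => ?_⟩
          · exact hxcR.symm.trans h
          · exact hxcR.trans h
        rw [← heq] at hcs
        exact hxb hcs
      have hTmem : T ∈ 𝒯.filter fun T => x ∈ T := by
        refine Finset.mem_filter.2 ⟨h𝒯mem.2 ⟨fun z hz => ?_, by omega⟩, hxT⟩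
        obtain ⟨hzA, hxz⟩ := Finset.mem_filter.1 hz
        refine Finset.mem_erase.2 ⟨?_, hzA⟩
        rintro rfl
        exact hxc' hxz
      refine Set.mem_iUnion₂.2 ⟨T, hTmem, ?_, ?_⟩
      · intro t ht t' ht'
        have h1' : (openGraph ω).Reachable x t := (Finset.mem_filter.1 ht).2
        have h2' : (openGraph ω).Reachable x t' := (Finset.mem_filter.1 ht').2
        exact h1'.symm.trans h2'
      · intro t ht a ha hta
        obtain ⟨haA, haT⟩ := Finset.mem_sdiff.1 ha
        have h1' : (openGraph ω).Reachable x t := (Finset.mem_filter.1 ht).2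
        have hta' : (openGraph ω).Reachable t a := hta
        exact haT (Finset.mem_filter.2 ⟨haA, h1'.trans hta'⟩)
    exact h1.trans (h2.trans h3)
  -- (iii) the packing row of each big target `T ⊆ A ∖ c`
  have hrow : ∀ T ∈ 𝒯, (∑ x ∈ T, μ.real (src x) / β x) * H T ≤ tgt T := by
    intro T hT
    obtain ⟨hTsub, _⟩ := h𝒯mem.1 hT
    have hTA : T ⊆ A := hTsub.trans (Finset.erase_subset c A)
    obtain ⟨π, hπ⟩ : ∃ π : Finset (Finset (Fin n)),
        π = T.map ⟨fun x => ({x} : Finset (Fin n)), Finset.singleton_injective⟩ := ⟨_, rfl⟩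
    have hmemπ : ∀ {S}, S ∈ π ↔ ∃ x ∈ T, {x} = S := by
      intro S; rw [hπ, Finset.mem_map]; rfl
    have hsubπ : ∀ S ∈ π, S ⊆ T := by
      intro S hS
      obtain ⟨x, hx, rfl⟩ := hmemπ.1 hS
      exact Finset.singleton_subset_iff.2 hx
    have hcover : ∀ t ∈ T, ∃ S ∈ π, t ∈ S :=
      fun t ht => ⟨{t}, hmemπ.2 ⟨t, ht, rfl⟩, Finset.mem_singleton_self t⟩
    have hdisj : ∀ S ∈ π, ∀ S' ∈ π, S ≠ S' → Disjoint S S' := by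
      intro S hS S' hS' hne
      obtain ⟨x, _, rfl⟩ := hmemπ.1 hS
      obtain ⟨x', _, rfl⟩ := hmemπ.1 hS'
      exact Finset.disjoint_singleton_left.2 fun h => hne (by rw [Finset.mem_singleton.1 h])
    have hQ : ∀ S ∈ π, ∃ G : Set (Sym2 (Fin n)) → ℝ, Monotone G ∧
        ∀ ω, G (⋃ t ∈ (↑(A \ S) : Set (Fin n)), openEdgeCluster ω t) = Q.indicator 1 ω := by
      intro S hS
      obtain ⟨x, hx, rfl⟩ := hmemπ.1 hS
      have hcX : c ∈ (↑(A \ {x}) : Set (Fin n)) := by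
        rw [Finset.mem_coe, Finset.mem_sdiff, Finset.notMem_singleton]
        exact ⟨hc, fun h => (Finset.mem_erase.1 (hTsub hx)).1 h.symm⟩
      exact ⟨_, bigFn_monotone A c j, fun ω => bigFn_biUnion_openEdgeCluster A c j _ hcX ω⟩
    have key := levelPackingRatio w A T hTA o π π (subset_refl π) hsubπ hcover hdisj (fun _ => Q) hQ
      (fun S => μ.real ({ω | ∀ b ∈ S, ∀ a ∈ A \ S, ω ∉ openConn b a} ∩ Q)) (fun S _ => measureReal_nonneg)
      (fun S _ => le_refl _)
    subst hπ
    simp only [Finset.sum_map, Function.Embedding.coeFn_mk] at key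
    exact key
  -- (iv) the target atoms are disjoint pieces of the right event
  have hR : ∑ T ∈ 𝒯, tgt T ≤ μ.real {ω : BondConfig (Fin n) |
      j + 1 ≤ (A.filter fun z => ω ∈ openConn o z).card ∧ ω ∉ openConn o c} := by
    have hdisj : (↑𝒯 : Set (Finset (Fin n))).PairwiseDisjoint fun T => ET T ∩ (JT T ∩ DT T) := by
      intro T hT T' hT' hne
      rw [Function.onFun, Set.disjoint_left]
      rintro ω ⟨⟨t, ht, hot⟩, hJ, hD⟩ ⟨⟨t', ht', hot'⟩, hJ', hD'⟩
      have hTA : T ⊆ A := (h𝒯mem.1 hT).1.trans (Finset.erase_subset c A)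
      have hTA' : T' ⊆ A := (h𝒯mem.1 hT').1.trans (Finset.erase_subset c A)
      have hot1 : (openGraph ω).Reachable o t := hot
      have hot2 : (openGraph ω).Reachable o t' := hot'
      -- `t ↔ t'`, so `t' ∈ T` (else `D_T` is violated), and then `π(t') = T = T'`
      have ht'T : t' ∈ T := by
        by_contra h
        exact hD t ht t' (Finset.mem_sdiff.2 ⟨hTA' ht', h⟩) (hot1.symm.trans hot2)
      have e1 := filter_eq_of_block hTA ht'T hJ hD
      have e2 := filter_eq_of_block hTA' ht' hJ' hD'
      exact hne (e1.symm.trans e2)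
    rw [← measureReal_biUnion_finset hdisj fun T _ => hmeas _]
    refine measureReal_mono (Set.iUnion₂_subset fun T hT => ?_)
    rintro ω ⟨⟨t, ht, hot⟩, hJ, hD⟩
    obtain ⟨hTsub, hTcard⟩ := h𝒯mem.1 hT
    have hTA : T ⊆ A := hTsub.trans (Finset.erase_subset c A)
    have hot' : (openGraph ω).Reachable o t := hot
    have hπo : (A.filter fun z => ω ∈ (openConn o z : Set (BondConfig (Fin n)))) = T := by
      rw [← filter_eq_of_block hTA ht hJ hD]
      refine Finset.filter_congr fun z _ => ⟨fun h => ?_, fun h => ?_⟩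
      · exact hot'.symm.trans h
      · exact hot'.trans h
    refine ⟨by rw [hπo]; exact hTcard, fun hoc => ?_⟩
    have hcT : c ∈ T := by
      rw [← hπo]; exact Finset.mem_filter.2 ⟨hc, hoc⟩
    exact (Finset.mem_erase.1 (hTsub hcT)).1 rfl
  -- (v) assembly
  have hstep : ∀ x ∈ A.erase c, μ.real (src x) ≤
      (μ.real (src x) / β x) * ∑ T ∈ 𝒯.filter (fun T => x ∈ T), H T := by
    intro x hx
    rcases (hβ0 x).eq_or_lt with h0 | hpos
    · have : μ.real (src x) = 0 :=
        le_antisymm ((measureReal_mono (hsrc_sub x)).trans_eq h0.symm) measureReal_nonneg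
      rw [this, zero_div, zero_mul]
    · calc μ.real (src x) = μ.real (src x) / β x * β x := by field_simp
        _ ≤ μ.real (src x) / β x * ∑ T ∈ 𝒯.filter (fun T => x ∈ T), H T :=
            mul_le_mul_of_nonneg_left (hcov x hx) (div_nonneg measureReal_nonneg (hβ0 x))
  have hswap : ∑ x ∈ A.erase c, (μ.real (src x) / β x) * ∑ T ∈ 𝒯.filter (fun T => x ∈ T), H T =
      ∑ T ∈ 𝒯, (∑ x ∈ T, μ.real (src x) / β x) * H T := by
    simp_rw [Finset.mul_sum, Finset.sum_mul]
    refine Finset.sum_comm' fun x T => ⟨fun ⟨hx, hT⟩ => ?_, fun ⟨hxT, hT⟩ => ?_⟩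
    · obtain ⟨hT𝒯, hxT⟩ := Finset.mem_filter.1 hT
      exact ⟨hxT, hT𝒯⟩
    · exact ⟨(h𝒯mem.1 hT).1 hxT, Finset.mem_filter.2 ⟨hT, hxT⟩⟩
  calc μ.real {ω : BondConfig (Fin n) |
        (A.filter fun z => ω ∈ openConn o z).card = 1 ∧ j + 1 ≤ (A.filter fun z => ω ∈ openConn c z).card}
      ≤ ∑ x ∈ A.erase c, μ.real (src x) := hL
    _ ≤ ∑ x ∈ A.erase c, (μ.real (src x) / β x) * ∑ T ∈ 𝒯.filter (fun T => x ∈ T), H T :=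
        Finset.sum_le_sum hstep
    _ = ∑ T ∈ 𝒯, (∑ x ∈ T, μ.real (src x) / β x) * H T := hswap
    _ ≤ ∑ T ∈ 𝒯, tgt T := Finset.sum_le_sum hrow
    _ ≤ μ.real {ω : BondConfig (Fin n) |
        j + 1 ≤ (A.filter fun z => ω ∈ openConn o z).card ∧ ω ∉ openConn o c} := hR

end Summit.CriticalPhenomena.PercolationContinuityZ3.Theorems

end
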